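import Summits.RiemannHypothesis.RiemannHypothesis.Theses.WeilComb
import Summits.RiemannHypothesis.RiemannHypothesis.Theorems.WeilCombCombShapeAdmissible
import Summits.RiemannHypothesis.RiemannHypothesis.Theorems.WeilCombCombSubcriticalEffectiveAux
import Literature.NumberTheory.LFunctions.WeilExplicit
import Literature.NumberTheory.LFunctions.WeilExplicitArchTermProofs
import Literature.NumberTheory.LFunctions.WeilArchimedeanMoments
import Literature.NumberTheory.LFunctions.WeilArchimedeanPositivityProofs

/-!
# The archimedean diagonal of the fixed-shape comb in exact Bombieri form
(crux `WeilComb.CombShapePositivity`, item stmt-RiemannHypothesis-11229, line `Sketch`, towards the band stub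
`stub_windowCore`; siege k2, variation "explicit sums: three-term identity then termwise bounds")

Notation. `φ₀(u) = expNegInvGlue (1 - u²)` (the route's fixed bump, support `[-1, 1]`), `φ_ε(t) = ε⁻¹ φ₀(t/ε)`,
`ψ_ε = φ_ε ⋆ φ̃_ε`, `N = ‖φ₀‖₂²` (`weilNorm2Sq`), `U = ψ_ε(0) = ε⁻¹N`, `W_∞ = weilArchTerm`, and the real
autocorrelation of the bump `P₀(s) = ∫ φ₀(u) φ₀(u − s) du` (even, `P₀(0) = N`, `P₀ = 0` off `[-2, 2]`).

In the explicit three-term (matrix) identity of the comb form on the exact window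
(`weilQuadratic_comb_re_exactWindow_explicit`) the archimedean DIAGONAL coefficient is `W_∞(ψ_ε)`; the tree holds it
in digamma/Plancherel form (`weilArchTerm_psi_diag`) and two one-sided minorants (bathtub `1 + log(2I₀²/N)`,
`stub_subDiagPole`'s `5/2`). This file gives the EXACT Bombieri form, with the logarithm isolated in closed form:

**Statement** (`re_weilArchTerm_psi_diag_bombieri`). For `ε > 0`,

  `Re W_∞(ψ_ε) = ε⁻¹N · (log(cosh ε / sinh ε) − log 4π − γ) − ∫₀² (e^{εs/2} P₀(s) − N) / sinh(εs) ds`.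

Since `log coth ε = log(1/ε) + O(ε²)`, `1/sinh(εs) = (εs)⁻¹(1 + O(ε²))` and `e^{εs/2} − 1 = εs/2 · (1 + O(ε))`, this is
`Re W_∞(ψ_ε) = ε⁻¹[N(log(1/ε) − log 4π − γ) + 𝒞'] − I₀²/4 + O(ε)` with the single bump functional
`𝒞' = ∫₀² (N − P₀(s))/s ds` (numerically `𝒞'/N = 1.15278`, i.e. the diagonal constant `c_d = log 4π + γ − 𝒞'/N = 1.95546`
per unit `U`); the termwise bounds are carried out in the companion file `…ArchDiagBombieriBoundsK2.lean`.

**Proof.** Bombieri's form of the archimedean term (`weilArchTermBombieri_eq_weilArchTerm_holds`):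
`W_∞(k) = −(log 4π + γ)k(0) − ∫₀^∞ (e^{t/2}(k(t) + k(−t)) − 2k(0))/(2 sinh t) dt` with `k = ψ_ε = ↑P` real and even,
`P = 0` off `[−2ε, 2ε]`, `P(0) = ε⁻¹N`: the integrand is `(e^{t/2}P(t) − P(0))/sinh t`, integrable on `(0, ∞)`
(`integrableOn_bombieriMajorant`); on `(2ε, ∞)` it equals `−P(0)/sinh t` and `∫_{2ε}^∞ dt/sinh t = log(cosh ε/sinh ε)`
(primitive `log tanh(t/2) = log(1 − e^{−t}) − log(1 + e^{−t})`); on `(0, 2ε]` substitute `t = εs` and use the dilation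
`P(εs) = ε⁻¹P₀(s)`.
-/

noncomputable section

-- the sub-problem path RiemannHypothesis/RiemannHypothesis duplicates a namespace (D-0017)
set_option linter.dupNamespace false

open scoped BigOperators ComplexConjugate Topology
open Complex MeasureTheory Set Filter

namespace Summit.RiemannHypothesis.RiemannHypothesis.Theorems.WeilCombBohrFejer

open Literature.NumberTheory.LFunctions

/-! ### The tail integral `∫_{2ε}^∞ dt / sinh t = log(cosh ε / sinh ε)` -/

/-- `F(t) = log(1 − e^{−t}) − log(1 + e^{−t})` (`= log tanh(t/2)`) has `F'(t) = 1/sinh t` for `t > 0`. [folklore] -/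
private theorem hasDerivAt_logTanhHalf_diagB {t : ℝ} (ht : 0 < t) :
    HasDerivAt (fun x : ℝ => Real.log (1 - Real.exp (-x)) - Real.log (1 + Real.exp (-x)))
      (Real.sinh t)⁻¹ t := by
  have he : HasDerivAt (fun x : ℝ => Real.exp (-x)) (-Real.exp (-t)) t :=
    ((hasDerivAt_neg t).exp).congr_deriv (by ring)
  have h1 : HasDerivAt (fun x : ℝ => 1 - Real.exp (-x)) (Real.exp (-t)) t := by
    simpa using he.const_sub 1
  have h2 : HasDerivAt (fun x : ℝ => 1 + Real.exp (-x)) (-Real.exp (-t)) t := by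
    simpa using he.const_add 1
  have hlt : Real.exp (-t) < 1 := Real.exp_lt_one_iff.2 (by linarith)
  have hpos : 0 < Real.exp (-t) := Real.exp_pos _
  have hne1 : 1 - Real.exp (-t) ≠ 0 := by linarith
  have hne2 : 1 + Real.exp (-t) ≠ 0 := by linarith
  have hne3 : 1 - Real.exp (-t) * Real.exp (-t) ≠ 0 := by nlinarith
  have hne3' : 1 - Real.exp (-t) ^ 2 ≠ 0 := by rw [sq]; exact hne3
  have h : HasDerivAt (fun x : ℝ => Real.log (1 - Real.exp (-x)) - Real.log (1 + Real.exp (-x)))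
      (Real.exp (-t) / (1 - Real.exp (-t)) - -Real.exp (-t) / (1 + Real.exp (-t))) t :=
    (h1.log hne1).fun_sub (h2.log hne2)
  refine h.congr_deriv ?_
  have hs : Real.exp (-t) / (1 - Real.exp (-(2 * t))) = 1 / (2 * Real.sinh t) :=
    exp_neg_div_one_sub_exp ht
  have e2 : Real.exp (-(2 * t)) = Real.exp (-t) * Real.exp (-t) := by
    rw [← Real.exp_add]; ring_nf
  rw [e2] at hs
  have hsinh : 0 < Real.sinh t := Real.sinh_pos_iff.2 ht
  have key : Real.exp (-t) / (1 - Real.exp (-t)) - -Real.exp (-t) / (1 + Real.exp (-t)) =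
      2 * (Real.exp (-t) / (1 - Real.exp (-t) * Real.exp (-t))) := by
    rw [div_sub_div _ _ hne1 hne2, ← mul_div_assoc, div_eq_div_iff (mul_ne_zero hne1 hne2) hne3]
    ring
  rw [key, hs]
  field_simp

/-- `F(t) = log(1 − e^{−t}) − log(1 + e^{−t}) → 0` as `t → ∞`. [folklore] -/
private theorem tendsto_logTanhHalf_diagB :
    Tendsto (fun x : ℝ => Real.log (1 - Real.exp (-x)) - Real.log (1 + Real.exp (-x))) atTop (𝓝 0) := by
  have h0 : Tendsto (fun x : ℝ => Real.exp (-x)) atTop (𝓝 0) := Real.tendsto_exp_neg_atTop_nhds_zero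
  have h1 := (h0.const_sub 1).log (by norm_num : (1 : ℝ) - 0 ≠ 0)
  have h2 := (h0.const_add 1).log (by norm_num : (1 : ℝ) + 0 ≠ 0)
  have h := h1.sub h2
  simpa using h

/-- `∫_{2ε}^∞ dt / sinh t = log(cosh ε / sinh ε)` for `ε > 0`
(FTC on `(2ε, ∞)` for the increasing primitive `log tanh(t/2)`, and `1 ∓ e^{−2ε} = 2e^{−ε} sinh ε`, resp. `cosh ε`).
[folklore] -/
private theorem integral_Ioi_inv_sinh_diagB {ε : ℝ} (hε : 0 < ε) :
    ∫ t in Ioi (2 * ε), (Real.sinh t)⁻¹ = Real.log (Real.cosh ε / Real.sinh ε) := by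
  have hderiv : ∀ x ∈ Ici (2 * ε), HasDerivAt
      (fun x : ℝ => Real.log (1 - Real.exp (-x)) - Real.log (1 + Real.exp (-x))) (Real.sinh x)⁻¹ x :=
    fun x hx => hasDerivAt_logTanhHalf_diagB (lt_of_lt_of_le (by positivity) (mem_Ici.1 hx))
  have hpos : ∀ x ∈ Ioi (2 * ε), 0 ≤ (Real.sinh x)⁻¹ := fun x hx =>
    inv_nonneg.2 (Real.sinh_nonneg_iff.2 (by linarith [mem_Ioi.1 hx]))
  rw [integral_Ioi_of_hasDerivAt_of_nonneg' hderiv hpos tendsto_logTanhHalf_diagB, zero_sub]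
  have hprod : Real.exp (-ε) * Real.exp ε = 1 := by rw [← Real.exp_add]; simp
  have hsq : Real.exp (-(2 * ε)) = Real.exp (-ε) * Real.exp (-ε) := by
    rw [← Real.exp_add]; ring_nf
  have hs : 1 - Real.exp (-(2 * ε)) = 2 * Real.exp (-ε) * Real.sinh ε := by
    rw [Real.sinh_eq, hsq]
    linear_combination (-1 : ℝ) * hprod
  have hc : 1 + Real.exp (-(2 * ε)) = 2 * Real.exp (-ε) * Real.cosh ε := by
    rw [Real.cosh_eq, hsq]
    linear_combination (-1 : ℝ) * hprod
  rw [hs, hc]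
  have h2e : 0 < 2 * Real.exp (-ε) := by positivity
  have hsh : 0 < Real.sinh ε := Real.sinh_pos_iff.2 hε
  have hch : 0 < Real.cosh ε := Real.cosh_pos ε
  rw [Real.log_mul h2e.ne' hsh.ne', Real.log_mul h2e.ne' hch.ne', Real.log_div hch.ne' hsh.ne']
  ring

/-! ### The real autocorrelation of a real profile -/

/-- For a real profile `φ = ↑f`: `(φ ⋆ φ̃)(s) = ↑(∫ f(u) f(u − s) du)`. [folklore] -/
private theorem weilConv_weilReflect_ofReal_diagB (f : ℝ → ℝ) (s : ℝ) :
    weilConv (fun t : ℝ => ((f t : ℝ) : ℂ)) (weilReflect fun t : ℝ => ((f t : ℝ) : ℂ)) s =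
      ((∫ u, f u * f (u - s) : ℝ) : ℂ) := by
  -- adapted from `weilConv_weilReflect_ofReal` (private in `…ArchOffdiagBounds.lean`)
  rw [weilConv_apply, ← integral_complex_ofReal]
  congr 1 with u
  simp only [weilReflect, Complex.conj_ofReal, Complex.ofReal_mul, neg_sub]

/-- The real autocorrelation `s ↦ ∫ f(u) f(u − s) du` is even (translation invariance of Lebesgue measure).
[folklore] -/
private theorem autocorr_even_diagB (f : ℝ → ℝ) (s : ℝ) :
    ∫ u, f u * f (u - -s) = ∫ u, f u * f (u - s) := by
  have h : ∫ u, f u * f (u - -s) = ∫ u, (fun u => f u * f (u - -s)) (u - s) :=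
    (integral_sub_right_eq_self (fun u => f u * f (u - -s)) s).symm
  rw [h]
  refine integral_congr_ae (Filter.Eventually.of_forall fun u => ?_)
  have e : u - s - -s = u := by ring
  simp only [e]
  rw [mul_comm]

/-- If `supp f ⊆ [−a, a]` then `∫ f(u) f(u − s) du = 0` for `|s| > 2a`. [folklore] -/
private theorem autocorr_eq_zero_diagB {f : ℝ → ℝ} {a s : ℝ} (hsupp : Function.support f ⊆ Icc (-a) a)
    (hs : 2 * a < |s|) : ∫ u, f u * f (u - s) = 0 := by
  -- adapted from `autocorr_eq_zero` (private in `…ArchOffdiagBounds.lean`)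
  refine integral_eq_zero_of_ae (Filter.Eventually.of_forall fun u => ?_)
  simp only [Pi.zero_apply]
  by_cases hu : f u = 0
  · rw [hu, zero_mul]
  · have hu' : u ∈ Icc (-a) a := hsupp hu
    have hv : f (u - s) = 0 := by
      by_contra hv
      have hv' : u - s ∈ Icc (-a) a := hsupp hv
      rw [mem_Icc] at hu' hv'
      have : |s| ≤ 2 * a := abs_le.2 ⟨by linarith, by linarith⟩
      linarith
    rw [hv, mul_zero]

/-! ### The bump: real profile, dilation of the autocorrelation -/

/-- The support of the real dilated profile `f(t) = ε⁻¹ φ₀(t/ε)` lies in `[−ε, ε]` (`ε > 0`). [folklore] -/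
private theorem support_dilBump_subset_diagB {ε : ℝ} (hε : 0 < ε) :
    Function.support (fun t : ℝ => ε⁻¹ * expNegInvGlue (1 - (t / ε) ^ 2)) ⊆ Icc (-ε) ε := by
  -- adapted from the proof of `weilArchTerm_translate_psi_offdiag_bounds`
  refine Function.support_subset_iff'.2 fun t ht => ?_
  have h1 : 1 - (t / ε) ^ 2 ≤ 0 := by
    rw [mem_Icc, not_and_or, not_le, not_le] at ht
    rcases ht with h | h
    · have h' : t / ε < -1 := by rw [div_lt_iff₀ hε]; linarith
      nlinarith
    · have h' : 1 < t / ε := by rw [lt_div_iff₀ hε]; linarith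
      nlinarith
  rw [expNegInvGlue.zero_of_nonpos h1, mul_zero]

/-- Dilation of the autocorrelation: with `f(t) = ε⁻¹ φ₀(t/ε)`,
`∫ f(u) f(u − εs) du = ε⁻¹ ∫ φ₀(w) φ₀(w − s) dw` (`u = εw`). [folklore] -/
private theorem autocorr_dilBump_diagB {ε : ℝ} (hε : 0 < ε) (s : ℝ) :
    ∫ u, (ε⁻¹ * expNegInvGlue (1 - (u / ε) ^ 2)) * (ε⁻¹ * expNegInvGlue (1 - ((u - ε * s) / ε) ^ 2)) =
      ε⁻¹ * ∫ w, expNegInvGlue (1 - w ^ 2) * expNegInvGlue (1 - (w - s) ^ 2) := by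
  have e : (fun u : ℝ => (ε⁻¹ * expNegInvGlue (1 - (u / ε) ^ 2)) *
      (ε⁻¹ * expNegInvGlue (1 - ((u - ε * s) / ε) ^ 2))) =
      fun u : ℝ => ε⁻¹ ^ 2 * ((fun w : ℝ => expNegInvGlue (1 - w ^ 2) * expNegInvGlue (1 - (w - s) ^ 2))
        (u / ε)) := by
    funext u
    have hw : (u - ε * s) / ε = u / ε - s := by field_simp
    rw [hw]
    ring
  rw [e, integral_const_mul, Measure.integral_comp_div
    (fun w : ℝ => expNegInvGlue (1 - w ^ 2) * expNegInvGlue (1 - (w - s) ^ 2)) ε, abs_of_pos hε, smul_eq_mul]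
  field_simp

/-! ### The main identity -/

/-- **The archimedean diagonal of the fixed-shape comb in exact Bombieri form.** For `ε > 0`, with
`φ_ε(t) = ε⁻¹φ₀(t/ε)`, `ψ_ε = φ_ε ⋆ φ̃_ε`, `N = ‖φ₀‖₂²`, `P₀(s) = ∫ φ₀(u)φ₀(u − s) du`:
`Re W_∞(ψ_ε) = ε⁻¹N (log(cosh ε / sinh ε) − log 4π − γ) − ∫₀² (e^{εs/2} P₀(s) − N)/sinh(εs) ds`
(Bombieri's form of `W_∞`, the tail `∫_{2ε}^∞ dt/sinh t = log coth ε`, and the dilation `ψ_ε(εs) = ε⁻¹P₀(s)`).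
[folklore] -/
theorem re_weilArchTerm_psi_diag_bombieri : ∀ ε : ℝ, 0 < ε →
    (weilArchTerm
        (weilConv (fun t : ℝ => (ε : ℂ)⁻¹ * ((expNegInvGlue (1 - (t / ε) ^ 2) : ℝ) : ℂ))
          (weilReflect (fun t : ℝ => (ε : ℂ)⁻¹ * ((expNegInvGlue (1 - (t / ε) ^ 2) : ℝ) : ℂ))))).re =
      ε⁻¹ * weilNorm2Sq (fun u : ℝ => ((expNegInvGlue (1 - u ^ 2) : ℝ) : ℂ)) *
          (Real.log (Real.cosh ε / Real.sinh ε) - Real.log (4 * Real.pi) - Real.eulerMascheroniConstant) -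
        ∫ s in (0 : ℝ)..2, (Real.exp (ε * s / 2) *
            (∫ u, expNegInvGlue (1 - u ^ 2) * expNegInvGlue (1 - (u - s) ^ 2)) -
              weilNorm2Sq (fun u : ℝ => ((expNegInvGlue (1 - u ^ 2) : ℝ) : ℂ))) / Real.sinh (ε * s) := by
  intro ε hε
  -- notation: the real profile `f`, the real autocorrelations `P` (of `f`) and `P₀` (of `φ₀`), `N`
  set f : ℝ → ℝ := fun t => ε⁻¹ * expNegInvGlue (1 - (t / ε) ^ 2) with hf
  set P : ℝ → ℝ := fun s => ∫ u, f u * f (u - s) with hP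
  set P₀ : ℝ → ℝ := fun s => ∫ u, expNegInvGlue (1 - u ^ 2) * expNegInvGlue (1 - (u - s) ^ 2) with hP₀
  set N : ℝ := weilNorm2Sq (fun u : ℝ => ((expNegInvGlue (1 - u ^ 2) : ℝ) : ℂ)) with hN
  set φε : ℝ → ℂ := fun t : ℝ => (ε : ℂ)⁻¹ * ((expNegInvGlue (1 - (t / ε) ^ 2) : ℝ) : ℂ) with hφε
  set ψ : ℝ → ℂ := weilConv φε (weilReflect φε) with hψ
  -- `φ_ε = ↑f` is a Weil test, `ψ = ↑P` is a Weil test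
  have hφf : φε = fun t : ℝ => ((f t : ℝ) : ℂ) := by
    funext t
    simp only [hφε, hf, Complex.ofReal_mul, Complex.ofReal_inv]
  have hφεW : IsWeilTest φε :=
    isWeilTest_dil (φ := fun u : ℝ => ((expNegInvGlue (1 - u ^ 2) : ℝ) : ℂ)) weilComb_shapeBump_isWeilTest hε.ne'
  have hψW : IsWeilTest ψ := hφεW.weilConv hφεW.weilReflect
  have hψP : ∀ s, ψ s = ((P s : ℝ) : ℂ) := fun s => by
    rw [hψ, hφf, weilConv_weilReflect_ofReal_diagB]
  -- `P` is even, continuous, vanishes off `[-2ε, 2ε]`, `P(0) = ε⁻¹N`, `P(εs) = ε⁻¹P₀(s)`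
  have hPeven : ∀ s, P (-s) = P s := fun s => autocorr_even_diagB f s
  have hPc : Continuous P := by
    have e : P = fun s => (ψ s).re := funext fun s => by rw [hψP, Complex.ofReal_re]
    rw [e]
    exact Complex.continuous_re.comp hψW.1.continuous
  have hPz : ∀ s, 2 * ε < |s| → P s = 0 := fun s hs =>
    autocorr_eq_zero_diagB (support_dilBump_subset_diagB hε) hs
  have hPdil : ∀ s, P (ε * s) = ε⁻¹ * P₀ s := fun s => autocorr_dilBump_diagB hε s
  have hP0 : P 0 = ε⁻¹ * N := by
    have h := hPdil 0
    rw [mul_zero] at h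
    rw [h, hN]
    congr 1
    simp only [hP₀, sub_zero]
    unfold weilNorm2Sq
    refine integral_congr_ae (Filter.Eventually.of_forall fun u => ?_)
    show expNegInvGlue (1 - u ^ 2) * expNegInvGlue (1 - u ^ 2) = ‖((expNegInvGlue (1 - u ^ 2) : ℝ) : ℂ)‖ ^ 2
    rw [Complex.norm_real, Real.norm_eq_abs, sq_abs, ← sq]
  -- Bombieri's form
  have hB : weilArchTerm ψ = -((Real.log (4 * Real.pi) + Real.eulerMascheroniConstant : ℂ) * ψ 0 +
      ∫ t in Ioi (0 : ℝ), ((Real.exp (t / 2) : ℂ) * (ψ t + ψ (-t)) - 2 * ψ 0) / (2 * Real.sinh t : ℂ)) := by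
    rw [← weilArchTermBombieri_eq_weilArchTerm_holds hψW]
    rfl
  -- the integrand in real form
  set g : ℝ → ℝ := fun t => (Real.exp (t / 2) * P t - P 0) / Real.sinh t with hg
  have hint : ∫ t in Ioi (0 : ℝ), ((Real.exp (t / 2) : ℂ) * (ψ t + ψ (-t)) - 2 * ψ 0) / (2 * Real.sinh t : ℂ) =
      ((∫ t in Ioi (0 : ℝ), g t : ℝ) : ℂ) := by
    rw [← integral_complex_ofReal]
    refine setIntegral_congr_fun measurableSet_Ioi fun t ht => ?_
    have hsinh : Real.sinh t ≠ 0 := (Real.sinh_pos_iff.2 (mem_Ioi.1 ht)).ne'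
    simp only [hψP, hPeven, hg]
    push_cast
    field_simp
    ring
  -- integrability of `g` on `(0, ∞)` (from Bombieri's majorant)
  have hgm : AEStronglyMeasurable g (volume.restrict (Ioi (0 : ℝ))) := by
    have : Continuous fun t => Real.exp (t / 2) * P t - P 0 := by fun_prop
    exact ((this.measurable.div Real.continuous_sinh.measurable).aestronglyMeasurable).restrict
  have hgi : IntegrableOn g (Ioi 0) := by
    have hmaj := integrableOn_bombieriMajorant hψW
    refine Integrable.mono' (hmaj.const_mul 2) hgm ?_
    refine (ae_restrict_iff' measurableSet_Ioi).2 (Filter.Eventually.of_forall fun t ht => ?_)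
    have hsinh : 0 < Real.sinh t := Real.sinh_pos_iff.2 (mem_Ioi.1 ht)
    have hnum : ‖(Real.exp (t / 2) : ℂ) * ψ t - ψ 0‖ = |Real.exp (t / 2) * P t - P 0| := by
      rw [hψP, hψP, ← Complex.ofReal_mul, ← Complex.ofReal_sub, Complex.norm_real, Real.norm_eq_abs]
    rw [hg, Real.norm_eq_abs, abs_div, abs_of_pos hsinh, hnum]
    apply le_of_eq
    field_simp
  -- split `(0, ∞) = (0, 2ε] ∪ (2ε, ∞)`
  have hsplit : ∫ t in Ioi (0 : ℝ), g t = (∫ t in Ioc (0 : ℝ) (2 * ε), g t) + ∫ t in Ioi (2 * ε), g t := by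
    rw [← Ioc_union_Ioi_eq_Ioi (by positivity : (0 : ℝ) ≤ 2 * ε),
      setIntegral_union Ioc_disjoint_Ioi_same measurableSet_Ioi
        (hgi.mono_set Ioc_subset_Ioi_self) (hgi.mono_set (Ioi_subset_Ioi (by positivity)))]
  -- the tail: `∫_{2ε}^∞ g = −P(0) log(cosh ε / sinh ε)`
  have htail : ∫ t in Ioi (2 * ε), g t = -(P 0) * Real.log (Real.cosh ε / Real.sinh ε) := by
    have e : ∫ t in Ioi (2 * ε), g t = ∫ t in Ioi (2 * ε), -(P 0) * (Real.sinh t)⁻¹ := by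
      refine setIntegral_congr_fun measurableSet_Ioi fun t ht => ?_
      have ht' : 2 * ε < t := mem_Ioi.1 ht
      have hPt : P t = 0 := hPz t (by rw [abs_of_pos (by linarith)]; exact ht')
      simp only [hg, hPt, mul_zero, zero_sub]
      ring
    rw [e, integral_const_mul, integral_Ioi_inv_sinh_diagB hε]
  -- the head: substitute `t = εs`
  have hhead : ∫ t in Ioc (0 : ℝ) (2 * ε), g t =
      ∫ s in (0 : ℝ)..2, (Real.exp (ε * s / 2) * P₀ s - N) / Real.sinh (ε * s) := by
    rw [← intervalIntegral.integral_of_le (by positivity : (0 : ℝ) ≤ 2 * ε)]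
    have hsub : (ε • ∫ s in (0 : ℝ)..2, g (ε * s)) = ∫ t in ε * 0..ε * 2, g t :=
      intervalIntegral.smul_integral_comp_mul_left g ε
    rw [mul_zero, (by ring : ε * 2 = 2 * ε)] at hsub
    rw [← hsub, smul_eq_mul, ← intervalIntegral.integral_const_mul]
    congr 1 with s
    rw [hg]
    simp only []
    rw [hPdil s, hP0, (by ring : ε * s / 2 = ε * s / 2)]
    have hε0 : ε ≠ 0 := hε.ne'
    by_cases hsh : Real.sinh (ε * s) = 0
    · rw [hsh, div_zero, div_zero, mul_zero]
    · field_simp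
  -- assemble
  have hre : (weilArchTerm ψ).re = -((Real.log (4 * Real.pi) + Real.eulerMascheroniConstant) * (ε⁻¹ * N) +
      ((∫ s in (0 : ℝ)..2, (Real.exp (ε * s / 2) * P₀ s - N) / Real.sinh (ε * s)) +
        -(ε⁻¹ * N) * Real.log (Real.cosh ε / Real.sinh ε))) := by
    rw [hB, hint, hsplit, htail, hhead, hψP 0, hP0]
    simp only [Complex.neg_re, Complex.add_re, Complex.ofReal_re]
    congr 2
    rw [← Complex.ofReal_add, ← Complex.ofReal_mul, Complex.ofReal_re]
  rw [hre]
  ring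

end Summit.RiemannHypothesis.RiemannHypothesis.Theorems.WeilCombBohrFejer

end
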